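/-
Copyright: the b2b-balaban T⁴-continuum CRUX team, row NE7b OWNER lineage `t4-ne7b-p1` (gen 127). Project licence.
-/
import Summits.QuantumFields.BalabanUV.T4Continuum.Spine.NE7b.SupFibreFiniteRangeDecomposition
import Mathlib.Analysis.Matrix.Order

/-!
# THE LAST-SCALE PIECE OF (273)'s DECOMPOSITION IS POSITIVE SEMIDEFINITE: `M_z⁻¹·R_J((4∕Λ)M_z) ≥ 0` — the inverse of the positive definite
# chart precision matrix and the tree's Fejér remainder `R_J` are positive semidefinite and COMMUTE (`R_J` is a polynomial in `M_z`), and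
# commuting nonnegative elements of the C⋆-algebra of matrices have a nonnegative product (Mathlib's `Commute.mul_nonneg` under
# `MatrixOrder`); so (273)'s splitting of the fluctuation covariance `C = Σ_{N<J} Γ_N + Γ_J^{rem}` is a sum of `J + 1` POSITIVE SEMIDEFINITE
# field covariances, the first `J` of finite range — the form in which the fluctuation field is a sum of `J + 1` independent Gaussian
# fields, `J` of them finite-range ((276)) (row NE7b, node U5c; (273) + Mathlib BY NAME; [folklore])

Cell `pub-balaban`, sub-cell `t4`, spine estimate NE7b (`T4WeightBudget.RelWeightBound`; the cell's OWN estimate — NOT PRINTED in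
[Bałaban 1983–89], NOT PROVED).  Crux-route work under `Spine/NE7b/` by the row OWNER (`t4-ne7b-p1` gen 127, file (278)) under FREEZE
(0)'s crux-prover clause, on § [NE7bP1-G126-HANDOFF] NEXT (3)(d), at TEA's level; NOTHING of Bałaban's is named as a Lean object, valued or
asserted; no `T4Continuum/Support` leaf typed; no `def`, no notation; zero `sorry`.  Imports (BY NAME): the OWNER's (273)
`…SupFibreFiniteRangeDecomposition` (`scaled_isHermitian`, `four_sub_scaled_posSemidef`, `inverse_frd`, `pushforward_posSemidef`,
`pushforward_hasFiniteRange`, `pushforward_add`, `pushforward_smul_sum`, `chart_hasFiniteRange`, `chart_dist_triangle`, `chart_dist_self`;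
through it (271) `chart_posDef`); the tree's `Literature/Analysis/Matrix/FiniteRangeDecomposition` (`posSemidef_frdRemainder`,
`commute_frdRemainder`, `posSemidef_frdPiece`, `hasFiniteRange_frdPiece`); Mathlib's `Commute.mul_nonneg` (C⋆-algebra order, scoped
`MatrixOrder`), `Matrix.PosDef.inv`.

WHY (located).  (273) proved the pieces `Γ_N` positive semidefinite and left the last-scale term `Γ_J^{rem} = Γ(M_z⁻¹R_J)` as «built from
the positive semidefinite `R_J`»; to read `C = ΣΓ_N + Γ_J^{rem}` as a decomposition of the Gaussian fluctuation field into INDEPENDENT summands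
(convolution of centred Gaussians, the tree's `multivariateGaussian_conv_multivariateGaussian`) every summand must be a covariance, i.e.
positive semidefinite.  `M_z⁻¹R_J` is a product of two commuting positive semidefinite matrices; Mathlib's order on the C⋆-algebra of
matrices gives its positivity in one line, with no square root or spectral bookkeeping in this file.

WHAT IS PROVED ([folklore]; `σ` finite; then (273)'s data):
* §1 **`posSemidef_mul_of_commute`** (two commuting positive semidefinite real matrices have a positive semidefinite product),
  `commute_nonsing_inv_smul` (`M⁻¹` commutes with `cM`).
* §2 **`inv_mul_frdRemainder_posSemidef`** (`M_z` positive definite, `4·1 − cM_z ≥ 0` ⟹ `M_z⁻¹R_J(cM_z) ≥ 0`),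
  **`remainder_pushforward_posSemidef`** (so is its pushforward `Γ_J^{rem}` to the field carrier).
* §3 THE END **`fibre_covariance_frd_psd`**: (273)'s decomposition restated with ALL `J + 1` summands positive semidefinite on the field carrier
  (and the `J` pieces of finite range `r + 2(2^N − 1)(r + R_H + r) + r`); §4 toy.

HONEST (what this is NOT).  One order-theoretic lemma by name; no size of the remainder (it is small only for `J` beyond the spectral floor
of `(4∕Λ)M_z` — the tree's symbol bound, not read here); the convolution ∕ independence reading is (276) + the tree, not restated; scalar
skeleton ((A3), NC-NE7b-α UNRULED); nothing of Bałaban's asserted.  BY-NAME EFFECT ON THE WALL: NONE.  NE7b NOT PRINTED ∕ NOT PROVED; spine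
PROVED 0∕9; rung (B)+1 — the programme's measures remain FINITE-torus statements; NOT the mass gap, NOT Clay.  HONEST DEPENDENCY: continuum
YM on T⁴ ⇐ BetaPertH ∧ nine spine estimates (0∕9 proved); BetaPertH ⇐ (D1) ∧ (D4) ∧ CAP+tail; G-an2-4 gates asym, D1 and NE2∕3∕4.
-/

set_option autoImplicit false

noncomputable section

namespace Summit.QuantumFields.BalabanUV.T4Continuum.NE7b.SupFibreFiniteRangeRemainder

open Matrix
open scoped MatrixOrder ComplexOrder
open Literature.Analysis.Matrix (HasFiniteRange frdPiece frdRemainder posSemidef_frdPiece posSemidef_frdRemainder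
  hasFiniteRange_frdPiece commute_frdRemainder)
open SupFibreGaussianCovariance (chart_posDef)
open SupFibreFiniteRangeDecomposition (scaled_isHermitian four_sub_scaled_posSemidef inverse_frd pushforward_posSemidef
  pushforward_hasFiniteRange pushforward_add pushforward_smul_sum chart_hasFiniteRange chart_dist_triangle chart_dist_self)

variable {ι : Type*} [Fintype ι] {σ : Type} [Fintype σ] [DecidableEq σ]
  {H : (ι → ℝ) →L[ℝ] (ι → ℝ) →L[ℝ] ℝ} {m p ΛH q : ℝ} (P : (σ → ℝ) →L[ℝ] (ι → ℝ))
  {dι : ι → ι → ℕ} {home : σ → ι} {r RH : ℕ}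

/-! ## §1. Commuting positive semidefinite matrices -/

omit [Fintype ι] in
/-- **COMMUTING POSITIVE SEMIDEFINITE REAL MATRICES HAVE A POSITIVE SEMIDEFINITE PRODUCT** (Mathlib's C⋆-order on matrices). [folklore] -/
theorem posSemidef_mul_of_commute {X Y : Matrix σ σ ℝ} (hX : X.PosSemidef) (hY : Y.PosSemidef) (h : Commute X Y) :
    (X * Y).PosSemidef :=
  (Commute.mul_nonneg hX.nonneg hY.nonneg h).posSemidef

omit [Fintype ι] in
/-- `M⁻¹` commutes with every scalar multiple of `M` (for `M` with invertible determinant). [folklore] -/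
theorem commute_nonsing_inv_smul {M : Matrix σ σ ℝ} (hM : IsUnit M.det) (c : ℝ) : Commute M⁻¹ (c • M) :=
  (show Commute M⁻¹ M by rw [Commute, SemiconjBy, nonsing_inv_mul _ hM, mul_nonsing_inv _ hM]).smul_right c

/-! ## §2. The last-scale piece -/

/-- **`M_z⁻¹·R_J(cM_z) ≥ 0`**: `H` symmetric with floor and ceiling, chart bound and ceiling ⟹ for `c = 4∕(Λ_Hq)` and every `J`, the product
of `M_z⁻¹` with the tree's Fejér remainder of `cM_z` is positive semidefinite. [folklore] -/
theorem inv_mul_frdRemainder_posSemidef (hHsym : ∀ h k : ι → ℝ, H h k = H k h)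
    (hfl : ∀ h : ι → ℝ, m * ∑ x, h x ^ 2 ≤ H h h) (hm : 0 < m) (hceil : ∀ h : ι → ℝ, H h h ≤ ΛH * ∑ x, h x ^ 2) (hΛH : 0 < ΛH)
    (hP : ∀ z : σ → ℝ, p * ∑ i, z i ^ 2 ≤ ∑ x, P z x ^ 2) (hp : 0 < p) (hPceil : ∀ z : σ → ℝ, ∑ x, P z x ^ 2 ≤ q * ∑ i, z i ^ 2)
    (hq : 0 < q) (Mz : Matrix σ σ ℝ) (hMz : ∀ j k, Mz j k = H (P (Pi.single j 1)) (P (Pi.single k 1))) (J : ℕ) :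
    (Mz⁻¹ * frdRemainder ((4 / (ΛH * q)) • Mz) J).PosSemidef := by
  have hpd := chart_posDef P hHsym hfl hm hP hp Mz hMz
  have hdet : IsUnit Mz.det := isUnit_iff_ne_zero.2 hpd.det_pos.ne'
  exact posSemidef_mul_of_commute hpd.inv.posSemidef
    (posSemidef_frdRemainder (scaled_isHermitian P hHsym Mz hMz _) (four_sub_scaled_posSemidef P hHsym hceil hΛH hPceil hq Mz hMz) J)
    (commute_frdRemainder (commute_nonsing_inv_smul hdet _) J)

/-- **THE LAST-SCALE FIELD COVARIANCE `Γ_J^{rem}` IS POSITIVE SEMIDEFINITE.** [folklore] -/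
theorem remainder_pushforward_posSemidef (hHsym : ∀ h k : ι → ℝ, H h k = H k h)
    (hfl : ∀ h : ι → ℝ, m * ∑ x, h x ^ 2 ≤ H h h) (hm : 0 < m) (hceil : ∀ h : ι → ℝ, H h h ≤ ΛH * ∑ x, h x ^ 2) (hΛH : 0 < ΛH)
    (hP : ∀ z : σ → ℝ, p * ∑ i, z i ^ 2 ≤ ∑ x, P z x ^ 2) (hp : 0 < p) (hPceil : ∀ z : σ → ℝ, ∑ x, P z x ^ 2 ≤ q * ∑ i, z i ^ 2)
    (hq : 0 < q) (Mz : Matrix σ σ ℝ) (hMz : ∀ j k, Mz j k = H (P (Pi.single j 1)) (P (Pi.single k 1))) (J : ℕ) :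
    (Matrix.of fun x y => ∑ j, ∑ k, P (Pi.single j 1) x * (Mz⁻¹ * frdRemainder ((4 / (ΛH * q)) • Mz) J) j k
      * P (Pi.single k 1) y).PosSemidef :=
  pushforward_posSemidef P (inv_mul_frdRemainder_posSemidef P hHsym hfl hm hceil hΛH hP hp hPceil hq Mz hMz J)

/-! ## §3. THE END: the decomposition with all summands positive semidefinite -/

/-- **HEADLINE — THE FLUCTUATION COVARIANCE IS A SUM OF `J + 1` COVARIANCES, `J` OF THEM OF FINITE RANGE.**  Under (273)'s hypotheses, for
every `J`: (i) `C(x,y) = Σ_{N<J} Γ_N(x,y) + Γ_J^{rem}(x,y)` entrywise; (ii) every `Γ_N` is positive semidefinite of field range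
`r + 2(2^N − 1)(r + R_H + r) + r`; (iii) `Γ_J^{rem}` is positive semidefinite. [folklore] -/
theorem fibre_covariance_frd_psd (hHsym : ∀ h k : ι → ℝ, H h k = H k h) (hfl : ∀ h : ι → ℝ, m * ∑ x, h x ^ 2 ≤ H h h) (hm : 0 < m)
    (hceil : ∀ h : ι → ℝ, H h h ≤ ΛH * ∑ x, h x ^ 2) (hΛH : 0 < ΛH)
    (hP : ∀ z : σ → ℝ, p * ∑ i, z i ^ 2 ≤ ∑ x, P z x ^ 2) (hp : 0 < p)
    (hPceil : ∀ z : σ → ℝ, ∑ x, P z x ^ 2 ≤ q * ∑ i, z i ^ 2) (hq : 0 < q)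
    (htri : ∀ x y w, dι x w ≤ dι x y + dι y w) (hsym : ∀ x y, dι x y = dι y x) (hd0 : ∀ x, dι x x = 0)
    (hHloc : ∀ h k : ι → ℝ, (∀ x y, h x ≠ 0 → k y ≠ 0 → RH < dι x y) → H h k = 0)
    (hPloc : ∀ j x, r < dι (home j) x → P (Pi.single j 1) x = 0)
    (Mz : Matrix σ σ ℝ) (hMz : ∀ j k, Mz j k = H (P (Pi.single j 1)) (P (Pi.single k 1))) (J : ℕ) :
    (∀ x y, (∑ j, ∑ k, P (Pi.single j 1) x * Mz⁻¹ j k * P (Pi.single k 1) y)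
        = (∑ N ∈ Finset.range J,
            ∑ j, ∑ k, P (Pi.single j 1) x * ((4 / (ΛH * q)) • frdPiece ((4 / (ΛH * q)) • Mz) N) j k * P (Pi.single k 1) y)
          + ∑ j, ∑ k, P (Pi.single j 1) x * (Mz⁻¹ * frdRemainder ((4 / (ΛH * q)) • Mz) J) j k * P (Pi.single k 1) y) ∧
    (∀ N, (Matrix.of fun x y =>
        ∑ j, ∑ k, P (Pi.single j 1) x * ((4 / (ΛH * q)) • frdPiece ((4 / (ΛH * q)) • Mz) N) j k * P (Pi.single k 1) y).PosSemidef ∧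
      HasFiniteRange dι (r + 2 * (2 ^ N - 1) * (r + RH + r) + r) (Matrix.of fun x y =>
        ∑ j, ∑ k, P (Pi.single j 1) x * ((4 / (ΛH * q)) • frdPiece ((4 / (ΛH * q)) • Mz) N) j k * P (Pi.single k 1) y)) ∧
    (Matrix.of fun x y => ∑ j, ∑ k, P (Pi.single j 1) x * (Mz⁻¹ * frdRemainder ((4 / (ΛH * q)) • Mz) J) j k
      * P (Pi.single k 1) y).PosSemidef := by
  have hAH := scaled_isHermitian P hHsym Mz hMz (4 / (ΛH * q))
  have hc : (0 : ℝ) ≤ 4 / (ΛH * q) := by positivity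
  have hAR : HasFiniteRange (fun j k => dι (home j) (home k)) (r + RH + r) ((4 / (ΛH * q)) • Mz) :=
    (chart_hasFiniteRange P htri hsym hHloc hPloc Mz hMz).smul _
  refine ⟨fun x y => ?_, fun N => ⟨pushforward_posSemidef P ((posSemidef_frdPiece hAH N).smul hc),
    pushforward_hasFiniteRange P htri hsym hPloc
      ((hasFiniteRange_frdPiece (chart_dist_triangle htri) (chart_dist_self hd0) hAR N).smul _)⟩,
    remainder_pushforward_posSemidef P hHsym hfl hm hceil hΛH hP hp hPceil hq Mz hMz J⟩
  conv_lhs => rw [inverse_frd P hHsym hfl hm hP hp Mz hMz (4 / (ΛH * q)) J]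
  rw [pushforward_add P, pushforward_smul_sum P]

/-! ## §4. Toy -/

/-- Toy: the identity matrix commutes with every scalar multiple of itself, so `1⁻¹·(c·1)`-type products stay positive semidefinite
(§1 with `X = Y = 1`). -/
example : ((1 : Matrix (Fin 2) (Fin 2) ℝ) * 1).PosSemidef :=
  posSemidef_mul_of_commute Matrix.PosSemidef.one Matrix.PosSemidef.one (Commute.refl _)

end Summit.QuantumFields.BalabanUV.T4Continuum.NE7b.SupFibreFiniteRangeRemainder
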